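import Literature.NumberTheory.DiophantineGeometry.GenEllConductorDifferent
import Literature.NumberTheory.NumberFields.DedekindDifferentBoundRelative
import Mathlib.RingTheory.DedekindDomain.Factorization
import HarnessLib

/-!
# [GenEll] Proposition 1.7 (i): the right inequality — the different is controlled by the conductor

S. Mochizuki, *Arithmetic elliptic curves in general position*, Math. J. Okayama Univ. 52 (2010)
[cite: MochizukiGenEll2010], Proposition 1.7 (i) pp. 9–10, read on the page: for `φ : Y → Z` with
`D = φ⁻¹(E)_red` and all ramification indices at `D` dividing `e`,
`log-cond_E − log-cond_D ≲ log-diff_Y − log-diff_Z ≲ (1 − 1/e) · log-cond_E`; printed proof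
(p. 10): outside a finite set `Σ` of primes the covering is tamely ramified and both inequalities
are EQUALITIES by the elementary theory of differents; over `Σ` the different is bounded (the
elementary claim on p. 10: the different of `L/K`, `[L:K] ≤ d`, contains `p^n 𝒪_L` with `n`
depending only on `p` and `d`).

This file PROVES the number-field content of the RIGHT inequality (companion of
`GenEllConductorDifferent`, which proves the left one), for a finite GALOIS extension `L/K` of
number fields of degree `n`: if every prime of `L` dividing the relative different lies over a
prime of the finite set `S` or divides `n`, then

  `logdisc L − logdisc K ≤ (1/[K:ℚ])·Σ_{v∈S} log N(v) − (1/[L:ℚ])·Σ_{v∈S} Σ_{w∣v} log N(w)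
                         + log n + log n!`                      (`logdisc_sub_logdisc_le_cond`)

— together with `cond_sub_cond_le_logdisc_sub_logdisc` of the companion file, the difference of
log-differents IS the conductor drop `log-cond_E − log-cond_D` up to a constant depending only on
the degree (no dependence on the point or on `[K:ℚ]`). Ingredients: Dedekind's bound
`v_w(𝔇_{L/K}) ≤ e_w − 1 + v_w(e_w)` for Galois `L/K` (tree,
`Literature.NumberTheory.NumberFields.succ_le_ramificationIdx_add_multiplicity_of_pow_dvd_differentIdeal_rel`,
Bombieri–Gubler B.2.11), the factorisation `N(I) = ∏_w N(w)^{v_w(I)}` (`log_absNorm_eq_sum_mul_log`),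
`v_w(e_w) ≤ v_w(n!)` and, at primes `w ∣ n` outside `S`, `e_w − 1 ≤ v_w(n)`; the two wild sums are
`≤ log N(n!·𝒪_L) = [L:ℚ]·log n!` and `≤ log N(n·𝒪_L) = [L:ℚ]·log n`. The per-prime identity
`n·log N(v) − Σ_{w∣v} log N(w) = Σ_{w∣v} (e_w − 1)·log N(w)` is the companion's
`finrank_mul_log_absNorm_sub_sum_log_absNorm_eq`. Non-Galois covers reduce to this by passing to
the Galois closure (`logdisc` is monotone in towers, `logdisc_le_logdisc`). Theorems only.
-/

noncomputable section

open NumberField IsDedekindDomain Ideal Module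

namespace Literature.NumberTheory.DiophantineGeometry.GenEll

section Factorisation

variable (L : Type*) [Field L] [NumberField L]

/-- `log N(I) = Σ_{w ∈ T} v_w(I)·log N(w)` for a nonzero ideal `I` of `𝓞_L` and any finite set `T`
of primes containing those with `v_w(I) ≠ 0` (unique factorisation, Mathlib
`Ideal.finprod_heightOneSpectrum_pow_multiplicity`). [folklore] -/
private theorem log_absNorm_eq_sum_mul_log {I : Ideal (𝓞 L)} (hI : I ≠ ⊥)
    (T : Finset (HeightOneSpectrum (𝓞 L)))
    (hT : ∀ w : HeightOneSpectrum (𝓞 L), multiplicity w.asIdeal I ≠ 0 → w ∈ T) :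
    Real.log (absNorm I : ℝ) =
      ∑ w ∈ T, (multiplicity w.asIdeal I : ℝ) * Real.log (absNorm w.asIdeal : ℝ) := by
  have hfac := Ideal.finprod_heightOneSpectrum_pow_multiplicity hI
  have hsupp : (Function.mulSupport fun w : HeightOneSpectrum (𝓞 L) =>
      w.asIdeal ^ multiplicity w.asIdeal I) ⊆ T := by
    intro w hw
    apply hT
    intro h0
    exact hw (show w.asIdeal ^ multiplicity w.asIdeal I = 1 by rw [h0, pow_zero])
  rw [finprod_eq_prod_of_mulSupport_subset _ hsupp] at hfac
  conv_lhs => rw [← hfac, map_prod, Nat.cast_prod]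
  rw [Real.log_prod]
  · refine Finset.sum_congr rfl fun w _ => ?_
    rw [map_pow, Nat.cast_pow, Real.log_pow]
  · intro w _
    rw [map_pow, Nat.cast_pow]
    exact pow_ne_zero _ (Nat.cast_ne_zero.mpr (by rw [Ne, Ideal.absNorm_eq_zero_iff]; exact w.ne_bot))

/-- `Σ_{w ∈ T} v_w(I)·log N(w) ≤ log N(I)` for every finite set `T` of primes. [folklore] -/
private theorem sum_mul_log_le_log_absNorm {I : Ideal (𝓞 L)} (hI : I ≠ ⊥)
    (T : Finset (HeightOneSpectrum (𝓞 L))) :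
    ∑ w ∈ T, (multiplicity w.asIdeal I : ℝ) * Real.log (absNorm w.asIdeal : ℝ) ≤
      Real.log (absNorm I : ℝ) := by
  classical
  have hfin : {w : HeightOneSpectrum (𝓞 L) | multiplicity w.asIdeal I ≠ 0}.Finite := by
    refine (Ideal.finite_factors hI).subset fun w hw => ?_
    simp only [Set.mem_setOf_eq] at hw ⊢
    exact (dvd_pow_self w.asIdeal hw).trans (pow_multiplicity_dvd w.asIdeal I)
  rw [log_absNorm_eq_sum_mul_log L hI (T ∪ hfin.toFinset)
    (fun w hw => Finset.mem_union_right _ (hfin.mem_toFinset.mpr hw))]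
  refine Finset.sum_le_sum_of_subset_of_nonneg Finset.subset_union_left fun w _ _ =>
    mul_nonneg (Nat.cast_nonneg _) (Real.log_nonneg ?_)
  exact_mod_cast Nat.one_le_iff_ne_zero.mpr (by rw [Ne, Ideal.absNorm_eq_zero_iff]; exact w.ne_bot)

/-- `log N(k·𝒪_L) = [L:ℚ]·log k` for a positive integer `k`. [folklore] -/
private theorem log_absNorm_span_natCast (k : ℕ) :
    Real.log (absNorm (Ideal.span {((k : ℕ) : 𝓞 L)}) : ℝ) = finrank ℚ L * Real.log k := by
  rw [Ideal.absNorm_span_singleton, show ((k : ℕ) : 𝓞 L) = algebraMap ℤ (𝓞 L) (k : ℤ) by simp,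
    Algebra.norm_algebraMap, NumberField.RingOfIntegers.rank, Int.natAbs_pow, Int.natAbs_natCast,
    Nat.cast_pow, Real.log_pow]

end Factorisation

section Engine

variable (K L : Type*) [Field K] [NumberField K] [Field L] [NumberField L] [Algebra K L]

/-- **Dedekind's bound, multiplicity form** (Galois `L/K`): for every prime `w` of `L`,
`v_w(𝔇_{L/K}) ≤ e_w − 1 + v_w(e_w)` (tree: Bombieri–Gubler B.2.11 over a number field).
[cite: MochizukiGenEll2010, Prop 1.7 (i) p.10] -/
theorem multiplicity_differentIdeal_le [IsGalois K L] (w : HeightOneSpectrum (𝓞 L)) :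
    multiplicity w.asIdeal (differentIdeal (𝓞 K) (𝓞 L)) ≤
      w.asIdeal.ramificationIdx (𝓞 K) - 1 +
        multiplicity w.asIdeal (Ideal.span {((w.asIdeal.ramificationIdx (𝓞 K) : ℕ) : 𝓞 L)}) := by
  have h := Literature.NumberTheory.NumberFields.succ_le_ramificationIdx_add_multiplicity_of_pow_dvd_differentIdeal_rel
    K L w.asIdeal w.ne_bot (pow_multiplicity_dvd w.asIdeal (differentIdeal (𝓞 K) (𝓞 L)))
  have he := Ideal.ramificationIdx_pos w.asIdeal (𝓞 K)
  omega

omit [NumberField K] in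
/-- The ramification index `e_w` (of `w` over `w ∩ 𝓞_K`) is at most `v_w(k·𝒪_L)` as soon as the
integer `k` lies in `w`: indeed `e_w = v_w(v·𝒪_L)` and `k ∈ v = w ∩ 𝓞_K`. [folklore] -/
private theorem ramificationIdx_le_multiplicity_span (w : HeightOneSpectrum (𝓞 L)) {k : ℕ}
    (hk0 : 0 < k) (hk : ((k : ℕ) : 𝓞 L) ∈ w.asIdeal) :
    w.asIdeal.ramificationIdx (𝓞 K) ≤
      multiplicity w.asIdeal (Ideal.span {((k : ℕ) : 𝓞 L)}) := by
  set v : HeightOneSpectrum (𝓞 K) := w.under (𝓞 K) with hv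
  haveI : w.asIdeal.LiesOver v.asIdeal := ⟨rfl⟩
  have hmap : v.asIdeal.map (algebraMap (𝓞 K) (𝓞 L)) ≠ ⊥ := Ideal.map_ne_bot_of_ne_bot v.ne_bot
  rw [Ideal.IsDedekindDomain.ramificationIdx_eq_multiplicity v.asIdeal w.asIdeal hmap]
  refine IsDedekindDomain.HeightOneSpectrum.multiplicity_le_of_ideal_ge w ?_ ?_
  · rw [Ideal.span_singleton_le_iff_mem]
    have hkK : ((k : ℕ) : 𝓞 K) ∈ v.asIdeal := by
      change ((k : ℕ) : 𝓞 K) ∈ w.asIdeal.comap (algebraMap (𝓞 K) (𝓞 L))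
      rw [Ideal.mem_comap, map_natCast]
      exact hk
    simpa using Ideal.mem_map_of_mem (algebraMap (𝓞 K) (𝓞 L)) hkK
  · rw [Ne, Ideal.span_singleton_eq_bot]
    exact_mod_cast hk0.ne'

/-- `v_w(e_w·𝒪_L) ≤ v_w(n!·𝒪_L)` since `1 ≤ e_w ≤ n = [L:K]` divides `n!`. [folklore] -/
private theorem multiplicity_span_ramificationIdx_le (w : HeightOneSpectrum (𝓞 L)) :
    multiplicity w.asIdeal (Ideal.span {((w.asIdeal.ramificationIdx (𝓞 K) : ℕ) : 𝓞 L)}) ≤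
      multiplicity w.asIdeal (Ideal.span {(((finrank K L).factorial : ℕ) : 𝓞 L)}) := by
  set e := w.asIdeal.ramificationIdx (𝓞 K) with he_def
  set v : HeightOneSpectrum (𝓞 K) := w.under (𝓞 K) with hv
  haveI : w.asIdeal.LiesOver v.asIdeal := ⟨rfl⟩
  have hepos : 0 < e := Ideal.ramificationIdx_pos w.asIdeal (𝓞 K)
  have hele : e ≤ finrank K L := by
    haveI := v.isMaximal
    have hmem : w.asIdeal ∈ IsDedekindDomain.primesOverFinset v.asIdeal (𝓞 L) :=
      (IsDedekindDomain.mem_primesOverFinset_iff v.ne_bot _).mpr ⟨w.isPrime, inferInstance⟩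
    have hsum := Ideal.sum_ramification_inertia (R := 𝓞 K) (𝓞 L) K L v.ne_bot
    have hle := Finset.single_le_sum (f := fun P => ramificationIdx' v.asIdeal P *
      inertiaDeg' v.asIdeal P) (fun _ _ => Nat.zero_le _) hmem
    rw [hsum] at hle
    have hf : 0 < inertiaDeg' v.asIdeal w.asIdeal := Ideal.inertiaDeg'_pos v.asIdeal w.asIdeal
    rw [he_def, ← Ideal.ramificationIdx'_eq_ramificationIdx v.asIdeal w.asIdeal v.ne_bot]
    exact le_trans (Nat.le_mul_of_pos_right _ hf) hle
  have hdvd : e ∣ (finrank K L).factorial := Nat.dvd_factorial hepos hele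
  refine IsDedekindDomain.HeightOneSpectrum.multiplicity_le_of_ideal_ge w ?_ ?_
  · exact Ideal.span_singleton_le_span_singleton.mpr (Nat.cast_dvd_cast hdvd)
  · rw [Ne, Ideal.span_singleton_eq_bot]
    exact_mod_cast (Nat.factorial_pos _).ne'

/-- **The right inequality of [GenEll] Prop. 1.7 (i), number-field content (Galois case).** Let `L/K`
be a finite Galois extension of number fields of degree `n` and `S` a finite set of primes of `K`
such that every prime `w` of `L` dividing the relative different `𝔇_{L/K}` lies over a prime of `S`
or contains `n` (i.e. `L/K` is unramified outside `S` and the primes dividing `n`). Then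
`logdisc L − logdisc K ≤ (1/[K:ℚ])·Σ_{v∈S} log N(v) − (1/[L:ℚ])·Σ_{v∈S} Σ_{w∣v} log N(w)
+ log n + log n!` — the different is the conductor drop up to a constant depending only on `n`.
[cite: MochizukiGenEll2010, Prop 1.7 (i) p.9] -/
theorem logdisc_sub_logdisc_le_cond [IsGalois K L] (S : Finset (HeightOneSpectrum (𝓞 K)))
    (hS : ∀ w : HeightOneSpectrum (𝓞 L), w.asIdeal ∣ differentIdeal (𝓞 K) (𝓞 L) →
      w.under (𝓞 K) ∈ S ∨ ((finrank K L : ℕ) : 𝓞 L) ∈ w.asIdeal) :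
    (finrank ℚ L : ℝ)⁻¹ * Real.log ((discr L).natAbs : ℝ) -
        (finrank ℚ K : ℝ)⁻¹ * Real.log ((discr K).natAbs : ℝ) ≤
      (finrank ℚ K : ℝ)⁻¹ * ∑ v ∈ S, Real.log (absNorm v.asIdeal : ℝ) -
        (finrank ℚ L : ℝ)⁻¹ * ∑ v ∈ S, ∑ w ∈ IsDedekindDomain.primesOverFinset v.asIdeal (𝓞 L),
          Real.log (absNorm w : ℝ) +
      (Real.log (finrank K L) + Real.log (finrank K L).factorial) := by
  classical
  set D := differentIdeal (𝓞 K) (𝓞 L) with hD_def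
  have hD : D ≠ ⊥ := differentIdeal_ne_bot
  set n := finrank K L with hn_def
  have hnpos : 0 < n := finrank_pos
  have hKpos : (0 : ℝ) < finrank ℚ K := by exact_mod_cast finrank_pos
  have hLpos : (0 : ℝ) < finrank ℚ L := by exact_mod_cast finrank_pos
  have htower : (finrank ℚ L : ℝ) = finrank ℚ K * n := by
    exact_mod_cast (finrank_mul_finrank ℚ K L).symm
  -- the finite set of primes: those dividing `𝔇` together with all primes above `S`
  have hfin₁ : {w : HeightOneSpectrum (𝓞 L) | multiplicity w.asIdeal D ≠ 0}.Finite := by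
    refine (Ideal.finite_factors hD).subset fun w hw => ?_
    simp only [Set.mem_setOf_eq] at hw ⊢
    exact (dvd_pow_self w.asIdeal hw).trans (pow_multiplicity_dvd w.asIdeal D)
  have hfin₂ : {w : HeightOneSpectrum (𝓞 L) | w.under (𝓞 K) ∈ S}.Finite := by
    have : {w : HeightOneSpectrum (𝓞 L) | w.under (𝓞 K) ∈ S} ⊆
        ⋃ v ∈ S, {w : HeightOneSpectrum (𝓞 L) | w.asIdeal ∈ v.asIdeal.primesOver (𝓞 L)} := by
      intro w hw
      simp only [Set.mem_setOf_eq, Set.mem_iUnion] at hw ⊢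
      exact ⟨w.under (𝓞 K), hw, w.isPrime, ⟨rfl⟩⟩
    refine Set.Finite.subset (Set.Finite.biUnion S.finite_toSet fun v _ => ?_) this
    exact (IsDedekindDomain.primesOver_finite v.asIdeal (𝓞 L)).preimage
      (fun w _ w' _ h => HeightOneSpectrum.ext h)
  set T : Finset (HeightOneSpectrum (𝓞 L)) := (hfin₁.union hfin₂).toFinset with hT_def
  have hT₁ : ∀ w, multiplicity w.asIdeal D ≠ 0 → w ∈ T := fun w hw =>
    (hfin₁.union hfin₂).mem_toFinset.mpr (Or.inl hw)
  have hT₂ : ∀ w : HeightOneSpectrum (𝓞 L), w.under (𝓞 K) ∈ S → w ∈ T := fun w hw =>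
    (hfin₁.union hfin₂).mem_toFinset.mpr (Or.inr hw)
  have hlogN : ∀ w : HeightOneSpectrum (𝓞 L), 0 ≤ Real.log (absNorm w.asIdeal : ℝ) := fun w =>
    Real.log_nonneg (Nat.one_le_cast.mpr
      (Nat.one_le_iff_ne_zero.mpr (by rw [Ne, Ideal.absNorm_eq_zero_iff]; exact w.ne_bot)))
  -- step 1: `log N(𝔇) = Σ_T d_w log N(w) ≤ Σ_T (e_w − 1) log N(w) + Σ_T v_w(e_w) log N(w)`
  have h1 : Real.log (absNorm D : ℝ) ≤
      ∑ w ∈ T, ((w.asIdeal.ramificationIdx (𝓞 K) : ℝ) - 1) * Real.log (absNorm w.asIdeal : ℝ) +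
        ∑ w ∈ T, (multiplicity w.asIdeal (Ideal.span {((n.factorial : ℕ) : 𝓞 L)}) : ℝ) *
          Real.log (absNorm w.asIdeal : ℝ) := by
    rw [log_absNorm_eq_sum_mul_log L hD T hT₁, ← Finset.sum_add_distrib]
    refine Finset.sum_le_sum fun w _ => ?_
    rw [← add_mul]
    refine mul_le_mul_of_nonneg_right ?_ (hlogN w)
    have hb := multiplicity_differentIdeal_le K L w
    have hf := multiplicity_span_ramificationIdx_le K L w
    have he : 1 ≤ w.asIdeal.ramificationIdx (𝓞 K) := Ideal.ramificationIdx_pos w.asIdeal (𝓞 K)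
    have : (multiplicity w.asIdeal D : ℝ) ≤
        ((w.asIdeal.ramificationIdx (𝓞 K) - 1 : ℕ) : ℝ) +
          (multiplicity w.asIdeal (Ideal.span {((n.factorial : ℕ) : 𝓞 L)}) : ℝ) := by
      exact_mod_cast hb.trans (Nat.add_le_add_left hf _)
    rwa [Nat.cast_sub he, Nat.cast_one] at this
  -- step 2: the wild sum `Σ_T v_w(n!) log N(w) ≤ [L:ℚ] log n!`
  have h2 : ∑ w ∈ T, (multiplicity w.asIdeal (Ideal.span {((n.factorial : ℕ) : 𝓞 L)}) : ℝ) *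
      Real.log (absNorm w.asIdeal : ℝ) ≤ finrank ℚ L * Real.log n.factorial := by
    rw [← log_absNorm_span_natCast L n.factorial]
    exact sum_mul_log_le_log_absNorm L (by
      rw [Ne, Ideal.span_singleton_eq_bot]; exact_mod_cast (Nat.factorial_pos n).ne') T
  -- step 3: split `Σ_T (e_w − 1) log N(w)` according to `w ∩ 𝓞_K ∈ S` or not
  have h3 : ∑ w ∈ T, ((w.asIdeal.ramificationIdx (𝓞 K) : ℝ) - 1) * Real.log (absNorm w.asIdeal : ℝ)
      = ∑ w ∈ T.filter (fun w => w.under (𝓞 K) ∈ S),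
          ((w.asIdeal.ramificationIdx (𝓞 K) : ℝ) - 1) * Real.log (absNorm w.asIdeal : ℝ) +
        ∑ w ∈ T.filter (fun w => w.under (𝓞 K) ∉ S),
          ((w.asIdeal.ramificationIdx (𝓞 K) : ℝ) - 1) * Real.log (absNorm w.asIdeal : ℝ) :=
    (Finset.sum_filter_add_sum_filter_not T _ _).symm
  -- step 3a: over `S`, the sum is the conductor drop (companion file)
  have h3a : ∑ w ∈ T.filter (fun w => w.under (𝓞 K) ∈ S),
      ((w.asIdeal.ramificationIdx (𝓞 K) : ℝ) - 1) * Real.log (absNorm w.asIdeal : ℝ) =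
      ∑ v ∈ S, ((n : ℝ) * Real.log (absNorm v.asIdeal : ℝ) -
        ∑ w ∈ IsDedekindDomain.primesOverFinset v.asIdeal (𝓞 L), Real.log (absNorm w : ℝ)) := by
    have hsplit : T.filter (fun w => w.under (𝓞 K) ∈ S) =
        S.biUnion (fun v => T.filter (fun w => w.under (𝓞 K) = v)) := by
      ext w
      simp only [Finset.mem_filter, Finset.mem_biUnion]
      exact ⟨fun ⟨hwT, hwS⟩ => ⟨_, hwS, hwT, rfl⟩, fun ⟨v, hv, hwT, hwv⟩ => ⟨hwT, hwv ▸ hv⟩⟩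
    rw [hsplit, Finset.sum_biUnion]
    · refine Finset.sum_congr rfl fun v hv => ?_
      haveI := v.isMaximal
      rw [finrank_mul_log_absNorm_sub_sum_log_absNorm_eq K L v.ne_bot,
        ← sum_filter_under_eq_sum_primesOverFinset K L v T (fun w hw => hT₂ w (hw ▸ hv))
          (fun P => ((ramificationIdx' v.asIdeal P : ℝ) - 1) * Real.log (absNorm P : ℝ))]
      refine Finset.sum_congr rfl fun w hw => ?_
      have hwv : w.under (𝓞 K) = v := (Finset.mem_filter.mp hw).2
      haveI : w.asIdeal.LiesOver v.asIdeal := ⟨by rw [← hwv]; rfl⟩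
      rw [Ideal.ramificationIdx'_eq_ramificationIdx v.asIdeal w.asIdeal v.ne_bot]
    · intro v _ v' _ hne
      simp only [Function.onFun]
      rw [Finset.disjoint_filter]
      exact fun w _ h h' => hne (h.symm.trans h')
  -- step 3b: outside `S` every `w ∈ T` divides `n`, and `e_w − 1 ≤ v_w(n)`; sum `≤ [L:ℚ] log n`
  have h3b : ∑ w ∈ T.filter (fun w => w.under (𝓞 K) ∉ S),
      ((w.asIdeal.ramificationIdx (𝓞 K) : ℝ) - 1) * Real.log (absNorm w.asIdeal : ℝ) ≤
      finrank ℚ L * Real.log n := by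
    have hle : ∀ w ∈ T.filter (fun w => w.under (𝓞 K) ∉ S),
        ((w.asIdeal.ramificationIdx (𝓞 K) : ℝ) - 1) * Real.log (absNorm w.asIdeal : ℝ) ≤
          (multiplicity w.asIdeal (Ideal.span {((n : ℕ) : 𝓞 L)}) : ℝ) *
            Real.log (absNorm w.asIdeal : ℝ) := by
      intro w hw
      obtain ⟨hwT, hwS⟩ := Finset.mem_filter.mp hw
      refine mul_le_mul_of_nonneg_right ?_ (hlogN w)
      rcases ((hfin₁.union hfin₂).mem_toFinset.mp hwT) with hw1 | hw2
      · -- `w ∣ 𝔇`, `w ∩ 𝓞_K ∉ S` ⇒ `n ∈ w` ⇒ `e_w ≤ v_w(n)`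
        have hdvd : w.asIdeal ∣ D :=
          (dvd_pow_self w.asIdeal hw1).trans (pow_multiplicity_dvd w.asIdeal D)
        have hn : ((n : ℕ) : 𝓞 L) ∈ w.asIdeal := (hS w hdvd).resolve_left hwS
        have := ramificationIdx_le_multiplicity_span K L w hnpos hn
        have : (w.asIdeal.ramificationIdx (𝓞 K) : ℝ) ≤
            multiplicity w.asIdeal (Ideal.span {((n : ℕ) : 𝓞 L)}) := by exact_mod_cast this
        linarith
      · exact absurd hw2 hwS
    refine (Finset.sum_le_sum hle).trans ?_
    rw [← log_absNorm_span_natCast L n]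
    exact sum_mul_log_le_log_absNorm L (by
      rw [Ne, Ideal.span_singleton_eq_bot]; exact_mod_cast hnpos.ne') _
  -- assemble: `log N(𝔇) ≤ Σ_S (n log N(v) − Σ_w log N(w)) + [L:ℚ] (log n + log n!)`
  have hmain : Real.log (absNorm D : ℝ) ≤
      ∑ v ∈ S, ((n : ℝ) * Real.log (absNorm v.asIdeal : ℝ) -
        ∑ w ∈ IsDedekindDomain.primesOverFinset v.asIdeal (𝓞 L), Real.log (absNorm w : ℝ)) +
      finrank ℚ L * (Real.log n + Real.log n.factorial) := by
    rw [h3, h3a] at h1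
    linarith
  -- translate to log-discriminants and divide by `[L:ℚ] = [K:ℚ]·n`
  rw [hD_def] at hmain
  have hdisc := log_natAbs_discr_eq K L
  rw [Finset.sum_sub_distrib, ← Finset.mul_sum] at hmain
  have hK : (finrank ℚ K : ℝ)⁻¹ = (finrank ℚ L : ℝ)⁻¹ * n := by rw [htower]; field_simp
  rw [hK, hdisc]
  have hLinv : (0 : ℝ) < (finrank ℚ L : ℝ)⁻¹ := inv_pos.mpr hLpos
  have key := mul_le_mul_of_nonneg_left hmain hLinv.le
  have e1 : (finrank ℚ L : ℝ)⁻¹ * (finrank ℚ L * (Real.log n + Real.log n.factorial)) =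
      Real.log n + Real.log n.factorial := by field_simp
  rw [mul_add, e1, mul_sub] at key
  have e2 : (finrank ℚ L : ℝ)⁻¹ * (Real.log (absNorm (differentIdeal (𝓞 K) (𝓞 L)) : ℝ) +
      (n : ℝ) * Real.log ((discr K).natAbs : ℝ)) -
      (finrank ℚ L : ℝ)⁻¹ * n * Real.log ((discr K).natAbs : ℝ) =
      (finrank ℚ L : ℝ)⁻¹ * Real.log (absNorm (differentIdeal (𝓞 K) (𝓞 L)) : ℝ) := by ring
  rw [e2]
  have e3 : (finrank ℚ L : ℝ)⁻¹ * n * ∑ v ∈ S, Real.log (absNorm v.asIdeal : ℝ) =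
      (finrank ℚ L : ℝ)⁻¹ * ((n : ℝ) * ∑ v ∈ S, Real.log (absNorm v.asIdeal : ℝ)) := by ring
  rw [e3]
  linarith

end Engine

end Literature.NumberTheory.DiophantineGeometry.GenEll

end
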